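import Summits.RiemannHypothesis.RiemannHypothesis.Theorems.EtaLeadingQuarterSecondMomentZerosDiag
import Summits.RiemannHypothesis.RiemannHypothesis.Theorems.EtaLeadingQuarterSecondMomentZerosPairs
import Literature.NumberTheory.LFunctions.AFEHarmonicSums

/-!
# The second moment of the sharp eta vector at the zeros, zero side III: the off-diagonal of the
# dual sum summed over the zeros
(route EtaLeadingQuarter, item `EtaLeadingSecondMoment`, stmt-RiemannHypothesis-21791)

`γ_n = zetaOrdinate n`, `N(T) = zetaZeroCount T`,
`OFF(y,t) = ∑_{j ≠ k odd ≤ y} (jk)^{-1/2} cos(t (log k − log j))` (off-diagonal of the squared dual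
sum `‖∑_{k odd ≤ y} k^{-1/2-it}‖²`). From the pair bound of part II
(`EtaLeadingQuarterSecondMomentZerosPairs`, `Zeros.pair_le'`) and `∑_{j ≤ Y} 1/j ≤ 1 + log(Y+1)`:

* `offDiag_le` — UNDER RH there is `C ≥ 0` with, for `M ≥ 1`, `T₂ ≥ 1`,
  `M ∑_{n<N(T₂)} OFF(⌊γ_n/(πM)⌋, γ_n)/γ_n² ≤ C (1 + log T₂)⁴/M`.

With `T₂ = M (log M)^5` the right side tends to `0`. Nothing here bears on the truth of RH.
-/

noncomputable section

open Finset Filter Topology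
open scoped Real

set_option linter.dupNamespace false  -- the mandated namespace repeats `RiemannHypothesis`

namespace Summit.RiemannHypothesis.RiemannHypothesis.Theorems.EtaLeadingQuarter.Zeros

open Literature.NumberTheory.LFunctions

/-- **The off-diagonal of the dual sum over the zeros, under RH.** There is `C ≥ 0` with, for all
`M ≥ 1` and `T₂ ≥ 1`,
`M ∑_{n<N(T₂)} γ_n^{-2} ∑_{j ≠ k odd ≤ ⌊γ_n/(πM)⌋} (jk)^{-1/2} cos(γ_n(log k − log j)) ≤ C (1 + log T₂)⁴/M`.
[folklore] -/
theorem offDiag_le (hRH : RiemannHypothesis) :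
    ∃ C : ℝ, 0 ≤ C ∧ ∀ M : ℕ, 1 ≤ M → ∀ T₂ : ℝ, 1 ≤ T₂ →
      (M : ℝ) * ∑ n ∈ Finset.range (zetaZeroCount T₂),
          (∑ j ∈ (Finset.Icc 1 ⌊zetaOrdinate n / (π * M)⌋₊).filter Odd,
            ∑ k ∈ (Finset.Icc 1 ⌊zetaOrdinate n / (π * M)⌋₊).filter Odd,
              if j = k then (0 : ℝ) else
                1 / (Real.sqrt j * Real.sqrt k) * Real.cos (zetaOrdinate n * (Real.log k - Real.log j))) /
            zetaOrdinate n ^ 2 ≤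
        C * (1 + Real.log T₂) ^ 4 / M := by
  classical
  obtain ⟨C, hC0, hLG⟩ := MontgomeryOdlyzko.exists_abs_cosSum_add_le hRH
  refine ⟨10 * C, by positivity, fun M hM T₂ hT₂ ↦ ?_⟩
  have hπ := Real.pi_gt_three
  have hM0 : 0 < M := hM
  have hM1 : (1 : ℝ) ≤ M := by exact_mod_cast hM
  have hMpos : (0 : ℝ) < M := by linarith
  have hπM0 : 0 < π * (M : ℝ) := by positivity
  set L : ℝ := 1 + Real.log T₂ with hL
  have hlogT : 0 ≤ Real.log T₂ := Real.log_nonneg hT₂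
  set Y : ℕ := ⌊T₂ / (π * M)⌋₊ with hY
  set F : Finset ℕ := (Finset.Icc 1 Y).filter Odd with hF
  have hγ0 : ∀ n, 0 ≤ zetaOrdinate n := fun n ↦ (zetaOrdinate_pos_holds n).le
  have hyn : ∀ n ∈ Finset.range (zetaZeroCount T₂), ⌊zetaOrdinate n / (π * M)⌋₊ ≤ Y := by
    intro n hn
    rw [Finset.mem_range, ← Montgomery.zetaOrdinate_le_iff_lt] at hn
    exact Nat.floor_le_floor (div_le_div_of_nonneg_right hn hπM0.le)
  -- the summand as a function on `F × F`
  set g : ℕ → ℕ → ℕ → ℝ := fun j k n ↦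
    if (j : ℝ) * (π * M) ≤ zetaOrdinate n ∧ (k : ℝ) * (π * M) ≤ zetaOrdinate n then
      (if j = k then (0 : ℝ) else
        1 / (Real.sqrt j * Real.sqrt k) * Real.cos (zetaOrdinate n * (Real.log k - Real.log j))) /
        zetaOrdinate n ^ 2
    else 0 with hg
  have hset : ∀ n ∈ Finset.range (zetaZeroCount T₂),
      (Finset.Icc 1 ⌊zetaOrdinate n / (π * M)⌋₊).filter Odd =
        F.filter (fun k : ℕ ↦ (k : ℝ) * (π * M) ≤ zetaOrdinate n) := by
    intro n hn
    ext k
    simp only [hF, Finset.mem_filter, Finset.mem_Icc]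
    constructor
    · rintro ⟨⟨h1, h2⟩, ho⟩
      exact ⟨⟨⟨h1, h2.trans (hyn n hn)⟩, ho⟩, (le_floor_iff_mul_le hM0 (hγ0 n) k).1 h2⟩
    · rintro ⟨⟨⟨h1, -⟩, ho⟩, hle⟩
      exact ⟨⟨h1, (le_floor_iff_mul_le hM0 (hγ0 n) k).2 hle⟩, ho⟩
  have hinner : ∀ n ∈ Finset.range (zetaZeroCount T₂),
      (∑ j ∈ (Finset.Icc 1 ⌊zetaOrdinate n / (π * M)⌋₊).filter Odd,
        ∑ k ∈ (Finset.Icc 1 ⌊zetaOrdinate n / (π * M)⌋₊).filter Odd,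
          if j = k then (0 : ℝ) else
            1 / (Real.sqrt j * Real.sqrt k) * Real.cos (zetaOrdinate n * (Real.log k - Real.log j))) /
        zetaOrdinate n ^ 2 = ∑ j ∈ F, ∑ k ∈ F, g j k n := by
    intro n hn
    rw [hset n hn, Finset.sum_div, Finset.sum_filter]
    refine Finset.sum_congr rfl fun j _ ↦ ?_
    split_ifs with hj
    · rw [Finset.sum_div, Finset.sum_filter]
      refine Finset.sum_congr rfl fun k _ ↦ ?_
      simp only [hg, hj, true_and]
    · symm
      refine Finset.sum_eq_zero fun k _ ↦ ?_
      simp only [hg, hj, false_and, if_false]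
  rw [Finset.sum_congr rfl hinner, Finset.sum_comm]
  simp_rw [Finset.sum_comm (s := Finset.range (zetaZeroCount T₂)) (t := F)]
  -- each pair `(j, k) ∈ F × F`
  have hpair : ∀ j ∈ F, ∀ k ∈ F, ∑ n ∈ Finset.range (zetaZeroCount T₂), g j k n ≤
      5 * C * L ^ 2 / (2 * (M : ℝ) ^ 2) * (1 / ((j : ℝ) * k)) := by
    intro j hj k hk
    simp only [hF, Finset.mem_filter, Finset.mem_Icc] at hj hk
    have hB0 : 0 ≤ 5 * C * L ^ 2 / (2 * (M : ℝ) ^ 2) * (1 / ((j : ℝ) * k)) := by positivity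
    rcases lt_trichotomy j k with hlt | heq | hgt
    · -- `j < k`: the condition is `kπM ≤ γ_n`
      have hkT : (k : ℝ) * (π * M) ≤ T₂ := by
        have := (Nat.le_floor_iff (div_nonneg (by linarith) hπM0.le)).1 hk.1.2
        rwa [le_div_iff₀ hπM0] at this
      have e : ∑ n ∈ Finset.range (zetaZeroCount T₂), g j k n =
          1 / (Real.sqrt j * Real.sqrt k) *
            ∑ n ∈ (Finset.range (zetaZeroCount T₂)).filter (fun n ↦ (k : ℝ) * (π * M) ≤ zetaOrdinate n),
              Real.cos (zetaOrdinate n * (Real.log k - Real.log j)) / zetaOrdinate n ^ 2 := by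
        rw [Finset.mul_sum, Finset.sum_filter]
        refine Finset.sum_congr rfl fun n _ ↦ ?_
        have hne : j ≠ k := hlt.ne
        by_cases hkn : (k : ℝ) * (π * M) ≤ zetaOrdinate n
        · have hjn : (j : ℝ) * (π * M) ≤ zetaOrdinate n :=
            le_trans (by have : (j : ℝ) ≤ k := by exact_mod_cast hlt.le
                         nlinarith) hkn
          simp only [hg, hjn, hkn, and_self, if_true, hne, if_false]
          ring
        · simp only [hg, hkn, and_false, if_false]
      rw [e]
      exact pair_le' hC0.le hLG hj.1.1 hlt hM hT₂ hkT
    · subst heq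
      have : ∑ n ∈ Finset.range (zetaZeroCount T₂), g j j n = 0 :=
        Finset.sum_eq_zero fun n _ ↦ by simp only [hg]; split_ifs <;> simp
      rw [this]; exact hB0
    · -- `k < j`: symmetric
      have hjT : (j : ℝ) * (π * M) ≤ T₂ := by
        have := (Nat.le_floor_iff (div_nonneg (by linarith) hπM0.le)).1 hj.1.2
        rwa [le_div_iff₀ hπM0] at this
      have e : ∑ n ∈ Finset.range (zetaZeroCount T₂), g j k n =
          1 / (Real.sqrt k * Real.sqrt j) *
            ∑ n ∈ (Finset.range (zetaZeroCount T₂)).filter (fun n ↦ (j : ℝ) * (π * M) ≤ zetaOrdinate n),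
              Real.cos (zetaOrdinate n * (Real.log j - Real.log k)) / zetaOrdinate n ^ 2 := by
        rw [Finset.mul_sum, Finset.sum_filter]
        refine Finset.sum_congr rfl fun n _ ↦ ?_
        have hne : j ≠ k := hgt.ne'
        by_cases hjn : (j : ℝ) * (π * M) ≤ zetaOrdinate n
        · have hkn : (k : ℝ) * (π * M) ≤ zetaOrdinate n :=
            le_trans (by have : (k : ℝ) ≤ j := by exact_mod_cast hgt.le
                         nlinarith) hjn
          simp only [hg, hjn, hkn, and_self, if_true, hne, if_false]
          rw [show zetaOrdinate n * (Real.log k - Real.log j) = -(zetaOrdinate n * (Real.log j - Real.log k)) by ring,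
            Real.cos_neg]
          ring
        · simp only [hg, hjn, false_and, if_false]
      rw [e, show (1 : ℝ) / ((j : ℝ) * k) = 1 / ((k : ℝ) * j) by rw [mul_comm]]
      exact pair_le' hC0.le hLG hk.1.1 hgt hM hT₂ hjT
  -- sum over the pairs
  have hHY : ∑ j ∈ F, 1 / (j : ℝ) ≤ 2 * L := by
    calc ∑ j ∈ F, 1 / (j : ℝ) ≤ ∑ j ∈ Finset.Icc 1 Y, 1 / (j : ℝ) :=
          Finset.sum_le_sum_of_subset_of_nonneg (Finset.filter_subset _ _) fun j _ _ ↦ by positivity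
      _ ≤ 1 + Real.log (Y + 1) := AFE.sum_Icc_inv_le_log Y
      _ ≤ 2 * L := by
          have hY1 : (Y : ℝ) + 1 ≤ 2 * T₂ := by
            have : (Y : ℝ) ≤ T₂ / (π * M) := Nat.floor_le (div_nonneg (by linarith) hπM0.le)
            have : T₂ / (π * M) ≤ T₂ := div_le_self (by linarith) (by nlinarith)
            linarith
          have : Real.log ((Y : ℝ) + 1) ≤ Real.log (2 * T₂) := Real.log_le_log (by positivity) hY1
          rw [Real.log_mul (by norm_num) (by linarith)] at this
          linarith [Real.log_two_lt_d9]
  have hF0 : 0 ≤ ∑ j ∈ F, 1 / (j : ℝ) := Finset.sum_nonneg fun j _ ↦ by positivity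
  calc (M : ℝ) * ∑ j ∈ F, ∑ k ∈ F, ∑ n ∈ Finset.range (zetaZeroCount T₂), g j k n
      ≤ (M : ℝ) * ∑ j ∈ F, ∑ k ∈ F, 5 * C * L ^ 2 / (2 * (M : ℝ) ^ 2) * (1 / ((j : ℝ) * k)) := by
        gcongr with j hj k hk
        exact hpair j hj k hk
    _ = 5 * C * L ^ 2 / (2 * M) * ((∑ j ∈ F, 1 / (j : ℝ)) * (∑ k ∈ F, 1 / (k : ℝ))) := by
        rw [Finset.sum_mul_sum, Finset.mul_sum, Finset.mul_sum]
        refine Finset.sum_congr rfl fun j _ ↦ ?_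
        rw [Finset.mul_sum, Finset.mul_sum]
        refine Finset.sum_congr rfl fun k _ ↦ ?_
        rw [one_div_mul_one_div]
        field_simp
    _ ≤ 5 * C * L ^ 2 / (2 * M) * ((2 * L) * (2 * L)) := by
        gcongr
    _ = 10 * C * (1 + Real.log T₂) ^ 4 / M := by rw [hL]; ring

end Summit.RiemannHypothesis.RiemannHypothesis.Theorems.EtaLeadingQuarter.Zeros

end
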